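import Literature.AlgebraicGeometry.Frobenioids.PrimaryStepsTransport
import Literature.AnabelianGeometry.EtaleTheta.BiKummerOfModelCanonical
import Literature.AnabelianGeometry.EtaleTheta.BiKummerThm44SubTree

/-!
# [EtTh] Theorem 4.4 (ii): "`Ψ` preserves pairs of pre-steps whose divisors have disjoint supports" (sub-DAG
# row T44-L12, in print's form) DISCHARGED at the canonical model instance from [FrdI] Prop 4.1 (iii) /
# Thm 4.2 (ii) — proof-only companion

S. Mochizuki, *The étale theta function …*, Publ. RIMS **45** (2009) [MochizukiEtTh2009], §4, Thm 4.4 (ii),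
proof PDF p.95 ll.10–12: "it follows immediately from the category-theoreticity of sets of primes given in
[FrdI], Theorem 4.2, (ii), that `Ψ` preserves base-equivalent [cf. the existence of `Ψ^bs`!] pairs of pre-steps
whose `Div(−)`'s have disjoint supports".  Row T44-L12 of `plan/L2/SUBDAG-EtTh-Thm44.md`
(`Thm44Hyp.PreservesDisjointSupports`, `BiKummerThm44Sub.lean`) recorded this as a NAMED INPUT over the FREE
field `BiKummerSetting.DisjointSupports` (Def 4.1 (i)) — and, quantifying over ALL co-objective pairs, in a form
STRONGER than print's (which speaks of base-equivalent pairs of PRE-STEPS).  At the canonical model instance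
`BiKummerSetting.mkOfModelCanonical` (abc-iut-L2-t9) the field IS the [FrdI] Prop 4.1 (iii) predicate
"`∀ x, x ∣ a → x ∣ b → x = 1`", and PRINT's form of the row becomes a THEOREM along print's route, using
abc-iut-L1's kernel-checked [FrdI] Prop 4.1 (iii) (`PreFrobenioid.isCoprimary_iff_forall_dvd`, abc-iut-L1:
for pre-steps `ε, ι` into a common object, "`x_ε, x_ι` have no common divisor `≠ 0`" iff `ε, ι` are
CO-PRIMARY — every pre-step through which both factor by pre-steps is an isomorphism) and the categoricity of
co-primality under an equivalence preserving and reflecting pre-steps (`PreFrobenioid.coprimary_map_iff`,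
`PrimaryStepsTransport.lean`, the transport step of [FrdI] Thm 4.2 (ii)):
  `Div(s'), Div(s'')` coprime in `Φ₁(A)` ⟺ (`Base(s') = Base(s'')` an isomorphism) `x_{s'}, x_{s''}` coprime in
  `Φ₁(B)` ⟺ `(s', s'')` co-primary ⟺ `(Ψ s', Ψ s'')` co-primary ⟺ … ⟺ `Div(Ψ s'), Div(Ψ s'')` coprime.
"`Ψ` preserves pre-steps" is row T44-L03 (DERIVED, `BiKummerThm44SubFrdI.lean`); "reflects" is its consequence
`Thm44Hyp.isPreStep_of_map`; "`C_i` of isotropic type" is Thm 3.7 (i) (`thm37_i_isotropic_holds`, PROVED).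
Results:
* `forall_common_dvd_eq_one_iff_of_mulEquiv` — coprimality is invariant under monoid isomorphisms;
* `Thm44Hyp.isPreStep_inverse_map` — `Ψ⁻¹` preserves pre-steps (from T44-L03);
* `Thm44Hyp.coprime_div_map` — the transport above, ANY setting, inputs `C_i` Frobenioids + T44-L03;
* `thm44_ii_of_preSteps` — the (ii) fraction-pair assembly (`Discharge/Sec4Thm44ii`'s `thm44_ii_of`) with the
  disjointness input WEAKENED to print's form (base-equivalent pairs of pre-steps);
* `Thm44Hyp.disjointSupports_map_treeVocab` / `thm44_ii_treeVocab_of_frac` — at the canonical vocabularies for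
  settings reading Def 4.1 (i) as the Prop 4.1 (iii) predicate: inputs `Remark372 D₀ / D₀'`, `hBmon₁ / hBmon₂`,
  and, for (ii), the fraction clause of T44-L10 ([FrdI] Cor 4.10) ONLY;
* `Thm44Hyp.disjointSupports_map_mkOfModelCanonical`, `thm44_ii_mkOfModelCanonical_of_frac` — **the same for the
  canonical model instances**: T44-L12 (print's form) DISCHARGED; **Thm 4.4 (ii) fraction-pair clause ⇐
  {Rmk 3.7.2, `hBmon`, T44-L10 (b)}**.
HONEST FRAMING: refereed pre-IUT material ([EtTh] §4 over [FrdI] §4); no new `Prop` fact, no statement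
restated; the typed row T44-L12 in its STRONGER all-pairs form is NOT proved here; nothing here bears on
[IUTchIII] Cor. 3.12; typed ≠ proved — here PROVED (print's form).
-/

namespace Literature.AnabelianGeometry.EtaleTheta

open CategoryTheory Opposite Literature.AlgebraicGeometry.Frobenioids

namespace BiKummerSetting

universe u₀ v₀ u v w

/-- "No common divisor other than `0`" ([FrdI] Prop 4.1 (iii), multiplicatively: every common divisor is `1`)
is invariant under isomorphisms of monoids. [cite: MochizukiFrdI2008, Prop. 4.1 (iii) p.75] -/
theorem forall_common_dvd_eq_one_iff_of_mulEquiv {M N : Type*} [Monoid M] [Monoid N] (e : M ≃* N)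
    (a b : M) : (∀ x : M, x ∣ a → x ∣ b → x = 1) ↔ (∀ y : N, y ∣ e a → y ∣ e b → y = 1) := by
  constructor
  · intro hab y hya hyb
    have hx : e.symm y = 1 :=
      hab (e.symm y) ((map_dvd_iff e).1 (by simpa using hya)) ((map_dvd_iff e).1 (by simpa using hyb))
    simpa using congrArg e hx
  · intro hab x hxa hxb
    exact e.injective ((hab (e x) (map_dvd e hxa) (map_dvd e hxb)).trans (map_one e).symm)

variable {K : Type u₀} [Field K] {K' : Type u₀} [Field K'] {D₀ : Type u₀} [Category.{v₀} D₀]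
  {V : FrdIMonoidStub.{w}}
  {X₁ : SemiGraphs.TemperedArithmeticGroup.{u₀} K} {X₂ : SemiGraphs.TemperedArithmeticGroup.{u₀} K'}
  {D₀' : Type u₀} [Category.{v₀} D₀']
  {T₁ : RealifiedDivisorMonoids (D₀ := D₀) V} {T₂ : RealifiedDivisorMonoids (D₀ := D₀') V}
  {D₁ D₂ : Type u} [Category.{v} D₁] [Category.{v} D₂] {VD₁ : FrdICatStub.{u, v, w} D₁}
  {VD₂ : FrdICatStub.{u, v, w} D₂} {S₁ : BiKummerSetting X₁ T₁ D₁ VD₁} {S₂ : BiKummerSetting X₂ T₂ D₂ VD₂}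

/-! ### `Ψ⁻¹` preserves pre-steps -/

/-- `Ψ⁻¹` carries pre-steps to pre-steps: `Ψ(Ψ⁻¹ φ) ≅ φ` up to the counit isomorphisms, and `Ψ` reflects
pre-steps (`isPreStep_of_map`, from T44-L03). [cite: MochizukiEtTh2009, Thm 4.4 p.95] -/
theorem Thm44Hyp.isPreStep_inverse_map (h : Thm44Hyp S₁ S₂) (h3 : h.PreservesFrobeniusStructure)
    {X Y : S₂.C} {φ : X ⟶ Y} (hφ : S₂.IsPreStep φ) : S₁.IsPreStep (h.Ψ.inverse.map φ) := by
  have h₁ : S₂.IsPreStep (h.Ψ.counit.app X) := PreFrobenioid.isPreStep_of_isIso S₂.F _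
  have h₂ : S₂.IsPreStep (h.Ψ.counitInv.app Y) := PreFrobenioid.isPreStep_of_isIso S₂.F _
  have hc : S₂.IsPreStep (h.Ψ.counit.app X ≫ φ ≫ h.Ψ.counitInv.app Y) :=
    PreFrobenioid.IsPreStep.comp S₂.F h₁ (PreFrobenioid.IsPreStep.comp S₂.F hφ h₂)
  refine h.isPreStep_of_map h3 ?_
  rw [h.Ψ.fun_inv_map]
  exact hc

/-! ### T44-L12 in print's form, any setting: coprimality of `Div(s'), Div(s'')` is transported by `Ψ` -/

/-- **"`Ψ` preserves base-equivalent pairs of pre-steps whose `Div(−)`'s have disjoint supports"** (p.95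
ll.10–12), disjointness read as the [FrdI] Prop 4.1 (iii) predicate "every common divisor is `1`", ANY pair of
settings: for base-equivalent pre-steps `s', s'' : A → B` of `C₁` with `Div(s'), Div(s'') ∈ Φ₁(A)` coprime, the
divisors `Div(Ψ s'), Div(Ψ s'') ∈ Φ₂(Ψ A)` are coprime.  Route (print's "[FrdI] Thm 4.2 (ii)"): coprimality of
`Div(s'), Div(s'')` = coprimality of `x_{s'}, x_{s''} ∈ Φ₁(B)` (pull-back along the isomorphism
`Base(s') = Base(s'')`) = CO-PRIMALITY of `(s', s'')` ([FrdI] Prop 4.1 (iii), `isCoprimary_iff_forall_dvd`; `C_i`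
of isotropic type by Thm 3.7 (i)), which `Ψ` transports (`coprimary_map_iff`: `Ψ`, `Ψ⁻¹` preserve pre-steps by
T44-L03). [cite: MochizukiEtTh2009, Thm 4.4 p.95] -/
theorem Thm44Hyp.coprime_div_map (h : Thm44Hyp S₁ S₂)
    (hF₁ : PreFrobenioid.IsFrobenioid S₁.F) (hF₂ : PreFrobenioid.IsFrobenioid S₂.F)
    (h3 : h.PreservesFrobeniusStructure) {A B : S₁.C} {s' s'' : A ⟶ B}
    (h' : S₁.IsPreStep s') (h'' : S₁.IsPreStep s'') (hb : PreFrobenioid.BaseEquivalent S₁.F s' s'')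
    (hcop : ∀ x : S₁.tf.divisorMonoid.obj (op (PreFrobenioid.baseObj S₁.F A)),
      x ∣ PreFrobenioid.Div S₁.F s' → x ∣ PreFrobenioid.Div S₁.F s'' → x = 1) :
    ∀ y : S₂.tf.divisorMonoid.obj (op (PreFrobenioid.baseObj S₂.F (h.Ψ.functor.obj A))),
      y ∣ PreFrobenioid.Div S₂.F (h.Ψ.functor.map s') → y ∣ PreFrobenioid.Div S₂.F (h.Ψ.functor.map s'') →
        y = 1 := by
  have k' : S₂.IsPreStep (h.Ψ.functor.map s') := h.isPreStep_map h3 h'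
  have k'' : S₂.IsPreStep (h.Ψ.functor.map s'') := h.isPreStep_map h3 h''
  have kb : PreFrobenioid.BaseEquivalent S₂.F (h.Ψ.functor.map s') (h.Ψ.functor.map s'') :=
    h.baseEquivalent_map hb
  haveI : IsIso (PreFrobenioid.Base S₁.F s') := h'.2
  haveI : IsIso (PreFrobenioid.Base S₂.F (h.Ψ.functor.map s')) := k'.2
  -- (a) coprimality of `x_{s'}, x_{s''} ∈ Φ₁(B)`
  obtain ⟨e₁, he₁⟩ := PreFrobenioid.exists_mulEquiv_pull (Φ := S₁.tf.divisorMonoid)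
    (PreFrobenioid.Base S₁.F s')
  have ha' : e₁ (PreFrobenioid.invDiv S₁.F s' h'.2) = PreFrobenioid.Div S₁.F s' := by
    rw [he₁, PreFrobenioid.pull_invDiv]
  have ha'' : e₁ (PreFrobenioid.invDiv S₁.F s'' h''.2) = PreFrobenioid.Div S₁.F s'' := by
    rw [he₁, show PreFrobenioid.Base S₁.F s' = PreFrobenioid.Base S₁.F s'' from hb, PreFrobenioid.pull_invDiv]
  have hcop' : ∀ x, x ∣ PreFrobenioid.invDiv S₁.F s' h'.2 → x ∣ PreFrobenioid.invDiv S₁.F s'' h''.2 → x = 1 := by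
    refine (forall_common_dvd_eq_one_iff_of_mulEquiv e₁ _ _).mpr ?_
    rw [ha', ha'']
    exact hcop
  -- (b) co-primality of `(s', s'')`, (c) transported to `(Ψ s', Ψ s'')`
  have hco₁ := (PreFrobenioid.isCoprimary_iff_forall_dvd hF₁
    (TemperedFrobenioid.thm37_i_isotropic_holds S₁.tf) h' h'').mpr hcop'
  have hco₂ := (PreFrobenioid.coprimary_map_iff h.Ψ (fun _ _ φ hφ => h.isPreStep_map h3 hφ)
    (fun _ _ φ hφ => h.isPreStep_inverse_map h3 hφ) s' s'').mpr hco₁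
  -- (d) coprimality of `x_{Ψ s'}, x_{Ψ s''} ∈ Φ₂(Ψ B)`, (e) pulled back to `Φ₂(Ψ A)`
  have hcop₂ := (PreFrobenioid.isCoprimary_iff_forall_dvd hF₂
    (TemperedFrobenioid.thm37_i_isotropic_holds S₂.tf) k' k'').mp hco₂
  obtain ⟨e₂, he₂⟩ := PreFrobenioid.exists_mulEquiv_pull (Φ := S₂.tf.divisorMonoid)
    (PreFrobenioid.Base S₂.F (h.Ψ.functor.map s'))
  have hb' : e₂ (PreFrobenioid.invDiv S₂.F (h.Ψ.functor.map s') k'.2) =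
      PreFrobenioid.Div S₂.F (h.Ψ.functor.map s') := by
    rw [he₂, PreFrobenioid.pull_invDiv]
  have hb'' : e₂ (PreFrobenioid.invDiv S₂.F (h.Ψ.functor.map s'') k''.2) =
      PreFrobenioid.Div S₂.F (h.Ψ.functor.map s'') := by
    rw [he₂, show PreFrobenioid.Base S₂.F (h.Ψ.functor.map s') =
      PreFrobenioid.Base S₂.F (h.Ψ.functor.map s'') from kb, PreFrobenioid.pull_invDiv]
  have hfin := (forall_common_dvd_eq_one_iff_of_mulEquiv e₂ _ _).mp hcop₂
  rw [hb', hb''] at hfin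
  exact hfin

/-! ### Thm 4.4 (ii), fraction-pair clause, assembled with the disjointness input in print's form -/

/-- **[EtTh] Thm 4.4 (ii) ("`Ψ` preserves fraction-pairs") from its [FrdI] inputs, the disjointness input in
PRINT's form** — the assembly `thm44_ii_of` of `Discharge/Sec4Thm44ii.lean` with `hDS` weakened to
base-equivalent pairs of pre-steps (which is all a fraction-pair offers): `Ψ` preserves pre-steps (T44-L03),
`Ψ^birat = ψ` is compatible with the fractions `s'·(s'')⁻¹` (T44-L10 (b), [FrdI] Cor 4.10), and `Ψ` preserves
disjointness of supports of the divisors of base-equivalent pre-steps (T44-L12, [FrdI] Thm 4.2 (ii)).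
[cite: MochizukiEtTh2009, Thm 4.4 p.94] -/
theorem thm44_ii_of_preSteps (h : Thm44Hyp S₁ S₂)
    (ψ : ∀ A : S₁.C, S₁.biratUnits A ≃* S₂.biratUnits (h.Ψ.functor.obj A))
    (hPre : ∀ {A B : S₁.C} (s : A ⟶ B), S₁.IsPreStep s → S₂.IsPreStep (h.Ψ.functor.map s))
    (hfrac : ∀ {A B : S₁.C} (s' s'' : A ⟶ B) (h' : S₁.IsPreStep s') (h'' : S₁.IsPreStep s'')
      (hb : PreFrobenioid.BaseEquivalent S₁.F s' s'') (k' : S₂.IsPreStep (h.Ψ.functor.map s'))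
      (k'' : S₂.IsPreStep (h.Ψ.functor.map s''))
      (kb : PreFrobenioid.BaseEquivalent S₂.F (h.Ψ.functor.map s') (h.Ψ.functor.map s'')),
      S₂.fracOf (h.Ψ.functor.map s') (h.Ψ.functor.map s'') k' k'' kb = ψ A (S₁.fracOf s' s'' h' h'' hb))
    (hDS : ∀ {A B : S₁.C} (s' s'' : A ⟶ B), S₁.IsPreStep s' → S₁.IsPreStep s'' →
      PreFrobenioid.BaseEquivalent S₁.F s' s'' → S₁.DisjointSupports (S₁.div s') (S₁.div s'') →
        S₂.DisjointSupports (S₂.div (h.Ψ.functor.map s')) (S₂.div (h.Ψ.functor.map s''))) :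
    Thm44_ii h ψ := by
  intro A B f P
  refine ⟨{ num := h.Ψ.functor.map P.num
            den := h.Ψ.functor.map P.den
            isPreStep_num := hPre _ P.isPreStep_num
            isPreStep_den := hPre _ P.isPreStep_den
            base_eq := h.baseEquivalent_map P.base_eq
            frac_eq := ?_
            disjointSupports := hDS _ _ P.isPreStep_num P.isPreStep_den P.base_eq P.disjointSupports },
    rfl, rfl⟩
  rw [hfrac P.num P.den P.isPreStep_num P.isPreStep_den P.base_eq, P.frac_eq]

/-- The same from the full T44-L10 input `BiratCompatible` ([FrdI] Cor 4.10: `Ψ^birat` compatible with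
restriction, fractions, `Aut`-actions) — only its fraction clause is used. [cite: MochizukiEtTh2009, Thm 4.4 p.94] -/
theorem thm44_ii_of_biratCompatible_of_preSteps (h : Thm44Hyp S₁ S₂)
    (ψ : ∀ A : S₁.C, S₁.biratUnits A ≃* S₂.biratUnits (h.Ψ.functor.obj A)) (h10 : h.BiratCompatible ψ)
    (hPre : ∀ {A B : S₁.C} (s : A ⟶ B), S₁.IsPreStep s → S₂.IsPreStep (h.Ψ.functor.map s))
    (hDS : ∀ {A B : S₁.C} (s' s'' : A ⟶ B), S₁.IsPreStep s' → S₁.IsPreStep s'' →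
      PreFrobenioid.BaseEquivalent S₁.F s' s'' → S₁.DisjointSupports (S₁.div s') (S₁.div s'') →
        S₂.DisjointSupports (S₂.div (h.Ψ.functor.map s')) (S₂.div (h.Ψ.functor.map s''))) :
    Thm44_ii h ψ :=
  thm44_ii_of_preSteps h ψ hPre (fun s' s'' h' h'' hb k' k'' kb => h10.frac s' s'' h' h'' hb k' k'' kb) hDS

/-- **T44-L12 (print's form) for settings reading Def 4.1 (i) "disjoint supports" as the [FrdI] Prop 4.1 (iii)
predicate** (as `mkOfModelCanonical` does): `Ψ` carries base-equivalent pairs of pre-steps with disjoint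
supports to such pairs; inputs `C_i` Frobenioids and T44-L03. [cite: MochizukiEtTh2009, Thm 4.4 p.95] -/
theorem Thm44Hyp.disjointSupports_map_of_inputs (h : Thm44Hyp S₁ S₂)
    (hS₁ : ∀ {A : D₁ᵒᵖ} (a b : S₁.tf.Φ.carrier A), S₁.DisjointSupports a b →
      ∀ x : S₁.tf.Φ.carrier A, x ∣ a → x ∣ b → x = 1)
    (hS₂ : ∀ {A : D₂ᵒᵖ} (a b : S₂.tf.Φ.carrier A), (∀ x : S₂.tf.Φ.carrier A, x ∣ a → x ∣ b → x = 1) →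
      S₂.DisjointSupports a b)
    (hF₁ : PreFrobenioid.IsFrobenioid S₁.F) (hF₂ : PreFrobenioid.IsFrobenioid S₂.F)
    (h3 : h.PreservesFrobeniusStructure) {A B : S₁.C} (s' s'' : A ⟶ B)
    (h' : S₁.IsPreStep s') (h'' : S₁.IsPreStep s'') (hb : PreFrobenioid.BaseEquivalent S₁.F s' s'')
    (hds : S₁.DisjointSupports (S₁.div s') (S₁.div s'')) :
    S₂.DisjointSupports (S₂.div (h.Ψ.functor.map s')) (S₂.div (h.Ψ.functor.map s'')) :=
  hS₂ _ _ (h.coprime_div_map hF₁ hF₂ h3 h' h'' hb (hS₁ _ _ hds))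

end BiKummerSetting

/-! ### At the canonical vocabularies: inputs `Remark372`, `hBmon` (and T44-L10 (b) for (ii)) only -/

namespace BiKummerSetting

universe u₀ v₀ u v w

variable {K : Type u₀} [Field K] {K' : Type u₀} [Field K'] {D₀ : Type u₀} [Category.{v₀} D₀]
  {X₁ : SemiGraphs.TemperedArithmeticGroup.{u₀} K} {X₂ : SemiGraphs.TemperedArithmeticGroup.{u₀} K'}
  {D₀' : Type u₀} [Category.{v₀} D₀']
  {T₁ : RealifiedDivisorMonoids (D₀ := D₀) treeMonoidVocab.{w}}
  {T₂ : RealifiedDivisorMonoids (D₀ := D₀') treeMonoidVocab.{w}}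
  {D₁ D₂ : Type u} [Category.{v} D₁] [Category.{v} D₂]
  {IsRational₁ IsStrictlyRational₁ : (D₁ᵒᵖ ⥤ CommMonCat.{w}) → Prop}
  {IsRational₂ IsStrictlyRational₂ : (D₂ᵒᵖ ⥤ CommMonCat.{w}) → Prop}

section TreeVocab

variable {S₁ : BiKummerSetting X₁ T₁ D₁ (treeCatVocab D₁ IsRational₁ IsStrictlyRational₁)}
  {S₂ : BiKummerSetting X₂ T₂ D₂ (treeCatVocab D₂ IsRational₂ IsStrictlyRational₂)}

/-- **T44-L03 at the canonical vocabularies, inputs `Remark372 D₀ / D₀'` and `hBmon₁ / hBmon₂` only** ("`C_i`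
Frobenioid" ⇐ `hBmon_i` via abc-iut's `isFrobenioid_treeCatVocab_of_isMonoidOn`; "`D_i` of FSM-type" ⇐ Rmk
3.7.2; "`Φ_i` non-dilating" = the Thm 4.4 hypothesis): `Ψ` preserves Frobenius degrees, isometries, morphisms
of Frobenius type and pull-backs. [cite: MochizukiEtTh2009, Thm 4.4 p.95] -/
theorem Thm44Hyp.preservesFrobeniusStructure_treeVocab (h : Thm44Hyp S₁ S₂)
    (h372 : TemperedFrobenioid.Remark372 D₀) (h372' : TemperedFrobenioid.Remark372 D₀')
    (hBmon₁ : IsMonoidOn S₁.tf.ratFnFunctor) (hBmon₂ : IsMonoidOn S₂.tf.ratFnFunctor) :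
    h.PreservesFrobeniusStructure :=
  h.preservesFrobeniusStructure_of_thm34 (S₁.tf.isFrobenioid_treeCatVocab_of_isMonoidOn hBmon₁)
    (S₂.tf.isFrobenioid_treeCatVocab_of_isMonoidOn hBmon₂) (h.isOfFSMType_base₁ h372.2.1)
    (h.isOfFSMType_base₂ h372'.2.1) h.isNonDilatingOn_ofFunctor₁ h.isNonDilatingOn_ofFunctor₂

/-- **T44-L12 (print's form) at the canonical vocabularies**, for settings reading Def 4.1 (i) as the [FrdI]
Prop 4.1 (iii) predicate: inputs `Remark372 D₀ / D₀'`, `hBmon₁ / hBmon₂` ONLY.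
[cite: MochizukiEtTh2009, Thm 4.4 p.95] -/
theorem Thm44Hyp.disjointSupports_map_treeVocab (h : Thm44Hyp S₁ S₂)
    (hS₁ : ∀ {A : D₁ᵒᵖ} (a b : S₁.tf.Φ.carrier A), S₁.DisjointSupports a b →
      ∀ x : S₁.tf.Φ.carrier A, x ∣ a → x ∣ b → x = 1)
    (hS₂ : ∀ {A : D₂ᵒᵖ} (a b : S₂.tf.Φ.carrier A), (∀ x : S₂.tf.Φ.carrier A, x ∣ a → x ∣ b → x = 1) →
      S₂.DisjointSupports a b)
    (h372 : TemperedFrobenioid.Remark372 D₀) (h372' : TemperedFrobenioid.Remark372 D₀')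
    (hBmon₁ : IsMonoidOn S₁.tf.ratFnFunctor) (hBmon₂ : IsMonoidOn S₂.tf.ratFnFunctor)
    {A B : S₁.C} (s' s'' : A ⟶ B) (h' : S₁.IsPreStep s') (h'' : S₁.IsPreStep s'')
    (hb : PreFrobenioid.BaseEquivalent S₁.F s' s'') (hds : S₁.DisjointSupports (S₁.div s') (S₁.div s'')) :
    S₂.DisjointSupports (S₂.div (h.Ψ.functor.map s')) (S₂.div (h.Ψ.functor.map s'')) :=
  h.disjointSupports_map_of_inputs hS₁ hS₂ (S₁.tf.isFrobenioid_treeCatVocab_of_isMonoidOn hBmon₁)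
    (S₂.tf.isFrobenioid_treeCatVocab_of_isMonoidOn hBmon₂)
    (h.preservesFrobeniusStructure_treeVocab h372 h372' hBmon₁ hBmon₂) s' s'' h' h'' hb hds

/-- **Thm 4.4 (ii), fraction-pair clause, at the canonical vocabularies** for settings reading Def 4.1 (i) as
the Prop 4.1 (iii) predicate: `Thm44_ii h ψ` ⇐ {`Remark372 D₀ / D₀'` (Rmk 3.7.2), `hBmon₁ / hBmon₂`, the fraction
clause of T44-L10 ([FrdI] Cor 4.10) for `ψ`} — T44-L03 and T44-L12 DISCHARGED. [cite: MochizukiEtTh2009, Thm 4.4 p.94] -/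
theorem thm44_ii_treeVocab_of_frac (h : Thm44Hyp S₁ S₂)
    (ψ : ∀ A : S₁.C, S₁.biratUnits A ≃* S₂.biratUnits (h.Ψ.functor.obj A))
    (hS₁ : ∀ {A : D₁ᵒᵖ} (a b : S₁.tf.Φ.carrier A), S₁.DisjointSupports a b →
      ∀ x : S₁.tf.Φ.carrier A, x ∣ a → x ∣ b → x = 1)
    (hS₂ : ∀ {A : D₂ᵒᵖ} (a b : S₂.tf.Φ.carrier A), (∀ x : S₂.tf.Φ.carrier A, x ∣ a → x ∣ b → x = 1) →
      S₂.DisjointSupports a b)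
    (h372 : TemperedFrobenioid.Remark372 D₀) (h372' : TemperedFrobenioid.Remark372 D₀')
    (hBmon₁ : IsMonoidOn S₁.tf.ratFnFunctor) (hBmon₂ : IsMonoidOn S₂.tf.ratFnFunctor)
    (hfrac : ∀ {A B : S₁.C} (s' s'' : A ⟶ B) (h' : S₁.IsPreStep s') (h'' : S₁.IsPreStep s'')
      (hb : PreFrobenioid.BaseEquivalent S₁.F s' s'') (k' : S₂.IsPreStep (h.Ψ.functor.map s'))
      (k'' : S₂.IsPreStep (h.Ψ.functor.map s''))
      (kb : PreFrobenioid.BaseEquivalent S₂.F (h.Ψ.functor.map s') (h.Ψ.functor.map s'')),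
      S₂.fracOf (h.Ψ.functor.map s') (h.Ψ.functor.map s'') k' k'' kb = ψ A (S₁.fracOf s' s'' h' h'' hb)) :
    Thm44_ii h ψ :=
  thm44_ii_of_preSteps h ψ
    (fun _ hs => h.isPreStep_map (h.preservesFrobeniusStructure_treeVocab h372 h372' hBmon₁ hBmon₂) hs) hfrac
    (fun s' s'' h' h'' hb hds => h.disjointSupports_map_treeVocab hS₁ hS₂ h372 h372' hBmon₁ hBmon₂ s' s''
      h' h'' hb hds)

end TreeVocab

/-! ### For the canonical model instances `mkOfModelCanonical` -/

section Model

variable (tf₁ : TemperedFrobenioid T₁ D₁ (treeCatVocab D₁ IsRational₁ IsStrictlyRational₁))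
  (hZ₁ : tf₁.monoidType = MonoidType.Z) (hP₁ : ∀ A : D₁ᵒᵖ, IsPerfect (tf₁.Φ.carrier A))
  (IG₁ : D₁ → Prop) (gS₁ : ∀ A : D₁, IG₁ A → (X₁.Pi →* Aut A))
  (gSs₁ : ∀ (A : D₁) (hA : IG₁ A), Function.Surjective (gS₁ A hA))
  (NH₁ : Subgroup (Field.absoluteGaloisGroup K) → tf₁.category → ℕ+ → Prop) (A₀₁ : tf₁.category)
  (hA₀₁ : PreFrobenioid.IsFrobeniusTrivial tf₁.toElem A₀₁) (hA₀₁' : IG₁ A₀₁.base)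
  (tf₂ : TemperedFrobenioid T₂ D₂ (treeCatVocab D₂ IsRational₂ IsStrictlyRational₂))
  (hZ₂ : tf₂.monoidType = MonoidType.Z) (hP₂ : ∀ A : D₂ᵒᵖ, IsPerfect (tf₂.Φ.carrier A))
  (IG₂ : D₂ → Prop) (gS₂ : ∀ A : D₂, IG₂ A → (X₂.Pi →* Aut A))
  (gSs₂ : ∀ (A : D₂) (hA : IG₂ A), Function.Surjective (gS₂ A hA))
  (NH₂ : Subgroup (Field.absoluteGaloisGroup K') → tf₂.category → ℕ+ → Prop) (A₀₂ : tf₂.category)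
  (hA₀₂ : PreFrobenioid.IsFrobeniusTrivial tf₂.toElem A₀₂) (hA₀₂' : IG₂ A₀₂.base)

/-- **T44-L12 (print's form) DISCHARGED for the canonical model instances**: for `S_i := mkOfModelCanonical …`
(Def 4.1 (i) := the [FrdI] Prop 4.1 (iii) predicate), `Ψ` carries base-equivalent pairs of pre-steps whose
divisors have disjoint supports to such pairs; inputs `Remark372 D₀ / D₀'`, `hBmon₁ / hBmon₂` only.
[cite: MochizukiEtTh2009, Thm 4.4 p.95] -/
theorem Thm44Hyp.disjointSupports_map_mkOfModelCanonical
    (h : Thm44Hyp (mkOfModelCanonical X₁ tf₁ hZ₁ hP₁ IG₁ gS₁ gSs₁ NH₁ A₀₁ hA₀₁ hA₀₁')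
      (mkOfModelCanonical X₂ tf₂ hZ₂ hP₂ IG₂ gS₂ gSs₂ NH₂ A₀₂ hA₀₂ hA₀₂'))
    (h372 : TemperedFrobenioid.Remark372 D₀) (h372' : TemperedFrobenioid.Remark372 D₀')
    (hBmon₁ : IsMonoidOn tf₁.ratFnFunctor) (hBmon₂ : IsMonoidOn tf₂.ratFnFunctor)
    {A B : tf₁.category} (s' s'' : A ⟶ B) (h' : PreFrobenioid.IsPreStep tf₁.toElem s')
    (h'' : PreFrobenioid.IsPreStep tf₁.toElem s'') (hb : PreFrobenioid.BaseEquivalent tf₁.toElem s' s'')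
    (hds : (mkOfModelCanonical X₁ tf₁ hZ₁ hP₁ IG₁ gS₁ gSs₁ NH₁ A₀₁ hA₀₁ hA₀₁').DisjointSupports
      (ModelFrobenioid.div s') (ModelFrobenioid.div s'')) :
    (mkOfModelCanonical X₂ tf₂ hZ₂ hP₂ IG₂ gS₂ gSs₂ NH₂ A₀₂ hA₀₂ hA₀₂').DisjointSupports
      (ModelFrobenioid.div (h.Ψ.functor.map s')) (ModelFrobenioid.div (h.Ψ.functor.map s'')) :=
  h.disjointSupports_map_treeVocab (fun _ _ hab => hab) (fun _ _ hab => hab) h372 h372' hBmon₁ hBmon₂ s' s''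
    h' h'' hb hds

/-- **[EtTh] Thm 4.4 (ii), fraction-pair clause `Thm44_ii`, for the canonical model instances ⇐ {Rmk 3.7.2
(`Remark372 D₀ / D₀'`), `hBmon₁ / hBmon₂`, the fraction clause of T44-L10 ([FrdI] Cor 4.10) for `ψ`}** — rows
T44-L03 and T44-L12 (print's form) DISCHARGED. [cite: MochizukiEtTh2009, Thm 4.4 p.94] -/
theorem thm44_ii_mkOfModelCanonical_of_frac
    (h : Thm44Hyp (mkOfModelCanonical X₁ tf₁ hZ₁ hP₁ IG₁ gS₁ gSs₁ NH₁ A₀₁ hA₀₁ hA₀₁')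
      (mkOfModelCanonical X₂ tf₂ hZ₂ hP₂ IG₂ gS₂ gSs₂ NH₂ A₀₂ hA₀₂ hA₀₂'))
    (ψ : ∀ A : tf₁.category, (mkOfModelCanonical X₁ tf₁ hZ₁ hP₁ IG₁ gS₁ gSs₁ NH₁ A₀₁ hA₀₁ hA₀₁').biratUnits A ≃*
      (mkOfModelCanonical X₂ tf₂ hZ₂ hP₂ IG₂ gS₂ gSs₂ NH₂ A₀₂ hA₀₂ hA₀₂').biratUnits (h.Ψ.functor.obj A))
    (h372 : TemperedFrobenioid.Remark372 D₀) (h372' : TemperedFrobenioid.Remark372 D₀')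
    (hBmon₁ : IsMonoidOn tf₁.ratFnFunctor) (hBmon₂ : IsMonoidOn tf₂.ratFnFunctor)
    (hfrac : ∀ {A B : tf₁.category} (s' s'' : A ⟶ B) (h' : PreFrobenioid.IsPreStep tf₁.toElem s')
      (h'' : PreFrobenioid.IsPreStep tf₁.toElem s'') (hb : PreFrobenioid.BaseEquivalent tf₁.toElem s' s'')
      (k' : PreFrobenioid.IsPreStep tf₂.toElem (h.Ψ.functor.map s'))
      (k'' : PreFrobenioid.IsPreStep tf₂.toElem (h.Ψ.functor.map s''))
      (kb : PreFrobenioid.BaseEquivalent tf₂.toElem (h.Ψ.functor.map s') (h.Ψ.functor.map s'')),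
      (mkOfModelCanonical X₂ tf₂ hZ₂ hP₂ IG₂ gS₂ gSs₂ NH₂ A₀₂ hA₀₂ hA₀₂').fracOf (h.Ψ.functor.map s')
          (h.Ψ.functor.map s'') k' k'' kb =
        ψ A ((mkOfModelCanonical X₁ tf₁ hZ₁ hP₁ IG₁ gS₁ gSs₁ NH₁ A₀₁ hA₀₁ hA₀₁').fracOf s' s'' h' h'' hb)) :
    Thm44_ii h ψ :=
  thm44_ii_treeVocab_of_frac h ψ (fun _ _ hab => hab) (fun _ _ hab => hab) h372 h372' hBmon₁ hBmon₂ hfrac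

end Model

end BiKummerSetting

end Literature.AnabelianGeometry.EtaleTheta
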